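import Summits.RiemannHypothesis.RiemannHypothesis.Theorems.PfPersistenceArithDialSpace
import Summits.RiemannHypothesis.RiemannHypothesis.Theorems.PfPersistenceGalerkinDensityTransfer
import Summits.RiemannHypothesis.RiemannHypothesis.Theorems.PfPersistenceF5TailTwins
import Summits.RiemannHypothesis.RiemannHypothesis.Theorems.RuelleBandExactFirstBandStubEvenCriterion
import Literature.NumberTheory.LFunctions.WeilCriterionProofs
import HarnessLib

/-!
# PF persistence — TALLY TWINS: the Markov-at-cutoff residual and the SUP density typed by name; the even
up-dial twin in the continuum (pub-rhpf barrier-typer gen 5, part 1 of 2; CLASS.md §4.3 W2, lead g9 GAL division)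

**HONEST FRAMING. This is a long-odds MECHANISM SEARCH; no RH claims.** Everything here is RH-free bookkeeping
between the cell's Galerkin records and the continuum model; the named `Prop`s are STATEMENTS (label TYPED) and the
theorems are reductions or elementary analysis.  Part 2 (`PfPersistenceTallyAccumulation`) assembles them into the
`DialReady`-free form of wall W2 on the tally domain.

## What is typed (statements only)

* `MarkovAtCutoff` — the MARKOV-AT-CUTOFF identity `Re Q(θ_v·1_{[-a,a]}) = P + 𝓔_a − M_a‖·‖²` at the NON-SMOOTH
  cut-off profiles, BY NAME (the right-hand side of cand-3's `galerkinMatrixIdentity_iff_markov_at_cutoff`;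
  `markovAtCutoff_iff_galerkinMatrixIdentity`).  It is exactly the residual making (ii′) ∘ (ii) ⇒ (ii″) NOT a pure
  composition (`testToGalerkinFormDensity_of_markovAtCutoff : MarkovAtCutoff → TestToProfileFormDensity →
  TestToGalerkinFormDensity`).
* `TestToProfileSupDensity` — GAL-1 density in SUP form: a smooth even real test on `[-a, a]` is approximated by
  cut-off cosine profiles `cutoffProfile (a, N) v` UNIFORMLY ON `ℝ`, in mass and in the Markov closed form (what a
  Fejér-means construction produces verbatim); it projects onto (ii‴) and (ii″)
  (`testToClosedFormDensity_of_sup`, `testToGalerkinFormDensity_of_sup`).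

## What is proved (RH-free unless a hypothesis says otherwise)

* `detectablyNegative_zeta_of_not_riemannHypothesis` — modulo (ii″): if RH fails, `ζ`'s datum is detectably negative.
* `exists_even_real_test_rayleigh_lt` — a smooth EVEN REAL test on `[-b, b]` with Rayleigh quotient below any
  `E > ε_ev(b)` (near-minimiser of the even sphere, split into real/imaginary parts).
* `twin_im_eq_zero`, `twin_even`, `re_twin_mul_re_twin_add`, `integral_re_twin_mul_shift` — the `σ = -1` twin
  `τ_{-c}g + τ_{c}g` of a real even `g` on `[-b, b]` (`b < c`) is real and EVEN, and its windowed autocorrelation at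
  lag `2c` over `[-(c+b), c+b]` equals `‖g‖²` (from F5's `twin_mul_conj_twin_add`).  (The deletion twins `K < 1` are
  ODD for even `g` — invisible to the even tally — which is why the accumulation uses UP-dials `K > 1`.)
* `abs_autocorr_sub_integral_le` — windowed autocorrelations move by `≤ 2a·δ(2M+δ)` under a sup-`δ` perturbation.
* `re_weilQuadratic_twin_lt` — F5-A (`tailDialNegativeOrZetaNotPositive`) with `K = 1 + t`, restated on `Q_ζ`:
  under Weil positivity on the window `log p/2 + b`, the even twin of a test with small Rayleigh quotient has
  `Re Q_ζ(twin) < 2t·(log p/√p)·‖g₁‖²`.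

References: E. Bombieri, Rend. Mat. Acc. Lincei (9) 11 (2000) §4; the cell files cited by name above.
-/

set_option linter.dupNamespace false

noncomputable section

open Real MeasureTheory Set Matrix Filter
open scoped Topology ComplexConjugate
open Literature.NumberTheory.LFunctions
open Summit.RiemannHypothesis.RiemannHypothesis.Theorems.PfPersistenceF5TailTwins

namespace Summit.RiemannHypothesis.RiemannHypothesis.Theorems.PfPersistence

/-! ## §1 Typed statements: Markov at the cut-off, and the SUP form of the GAL-1 density -/

/-- **TYPED — MARKOV AT THE CUT-OFF** (statement only; owner barrier-prover per lead g9 13:45:57Z): at every window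
and every coefficient vector, `Re Q` of the cut-off profile equals its Markov closed form
`P + 𝓔_a − M_a‖·‖²` (Bombieri's decomposition, known in the tree for SMOOTH tests only,
`re_weilQuadratic_eq_markovClosedForm`). Equivalent to `GalerkinMatrixIdentity` (cand-3,
`galerkinMatrixIdentity_iff_markov_at_cutoff`). (A `Prop`, statement only.) -/
def MarkovAtCutoff : Prop :=
  ∀ (win : Window) (v : Fin (win.N + 1) → ℝ),
    (weilQuadratic (cutoffProfile win v)).re = markovClosedForm win.a (cutoffProfile win v)

/-- PROVED: `MarkovAtCutoff ↔ GalerkinMatrixIdentity` (cand-3's equivalence, renamed). [folklore] -/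
theorem markovAtCutoff_iff_galerkinMatrixIdentity : MarkovAtCutoff ↔ GalerkinMatrixIdentity := by
  rw [galerkinMatrixIdentity_iff_markov_at_cutoff]
  rfl

/-- **PROVED — the residual of the (ii′) ∘ (ii) route, BY NAME:** `MarkovAtCutoff → (ii′) → (ii″)`. [folklore] -/
theorem testToGalerkinFormDensity_of_markovAtCutoff (hM : MarkovAtCutoff) (hD : TestToProfileFormDensity) :
    TestToGalerkinFormDensity :=
  testToGalerkinFormDensity_of_identity_of_density (markovAtCutoff_iff_galerkinMatrixIdentity.1 hM) hD

/-- **TYPED — GAL-1 DENSITY, SUP FORM** (statement only; the Fejér-means output): every smooth even real test `g`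
with `tsupport g ⊆ [-a, a]` is approximated by cut-off profiles `cutoffProfile (a, N) v` uniformly on `ℝ`, in mass,
and in the Markov closed form. (A `Prop`, statement only.) -/
def TestToProfileSupDensity : Prop :=
  ∀ (a : ℝ) (ha : 0 < a) (g : ℝ → ℂ), IsWeilTest g → tsupport g ⊆ Icc (-a) a → (∀ t, g (-t) = g t) →
    (∀ t, (g t).im = 0) → ∀ δ : ℝ, 0 < δ →
      ∃ (N : ℕ) (v : Fin (N + 1) → ℝ),
        (∀ x, ‖cutoffProfile ⟨a, N, ha⟩ v x - g x‖ ≤ δ) ∧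
          |(∫ t, ‖cutoffProfile ⟨a, N, ha⟩ v t‖ ^ 2) - ∫ t, ‖g t‖ ^ 2| ≤ δ ∧
            |markovClosedForm a (cutoffProfile ⟨a, N, ha⟩ v) - markovClosedForm a g| ≤ δ

/-- PROVED: the sup form projects onto (ii‴) `TestToClosedFormDensity`. [folklore] -/
theorem testToClosedFormDensity_of_sup (h : TestToProfileSupDensity) : TestToClosedFormDensity := by
  intro a ha g hg hs hev hre δ hδ
  obtain ⟨N, v, -, hm, hq⟩ := h a ha g hg hs hev hre δ hδ
  exact ⟨N, v, hm, hq⟩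

/-- PROVED: the sup form gives (ii″) `TestToGalerkinFormDensity`. [folklore] -/
theorem testToGalerkinFormDensity_of_sup (h : TestToProfileSupDensity) : TestToGalerkinFormDensity :=
  testToGalerkinFormDensity_of_closedForm (testToClosedFormDensity_of_sup h)

/-! ## §2 The `¬RH` branch: `ζ` itself is detectably negative (modulo (ii″)) -/

/-- PROVED (modulo (ii″)): all-window positivity of `ζ`'s datum implies RH (the typed dictionary discharged by
`galerkinToContinuum_of_galerkinDensity`, the even criterion `riemannHypothesis_iff_evenWeilPositivity`). [folklore] -/
theorem riemannHypothesis_of_allWindowsPositive_of_density (hD : TestToGalerkinFormDensity)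
    (hpos : AllWindowsPositive zetaDatum) : RiemannHypothesis :=
  riemannHypothesis_of_allWindowsPositive (galerkinToContinuum_of_galerkinDensity hD)
    RuelleBandExactFirstBand.riemannHypothesis_iff_evenWeilPositivity hpos

/-- PROVED (modulo (ii″)): if RH fails, `ζ`'s datum is detectably negative. [folklore] -/
theorem detectablyNegative_zeta_of_not_riemannHypothesis (hD : TestToGalerkinFormDensity)
    (h : ¬ RiemannHypothesis) : DetectablyNegative zetaDatum :=
  (detectablyNegative_iff_not_allWindowsPositive _).2 fun hpos =>
    h (riemannHypothesis_of_allWindowsPositive_of_density hD hpos)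

/-! ## §3 A real even near-minimiser of the even sector -/

/-- PROVED (RH-free): for `0 < b` and any `E > ε_ev(b)` there is a smooth EVEN REAL test on `[-b, b]` of positive
mass with Rayleigh quotient `< E` (near-minimiser of the even sphere, split into real and imaginary parts by the
tree's decoupling `re_weilQuadratic_eq_re_add_im`; the part with the smaller quotient is kept). [folklore] -/
theorem exists_even_real_test_rayleigh_lt {b E : ℝ} (hb : 0 < b) (hE : weilEvenGroundEnergy b < E) :
    ∃ g : ℝ → ℂ, IsWeilTest g ∧ tsupport g ⊆ Icc (-b) b ∧ (∀ t, g (-t) = g t) ∧ (∀ t, (g t).im = 0) ∧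
      0 < ∫ t, ‖g t‖ ^ 2 ∧ (weilQuadratic g).re < E * ∫ t, ‖g t‖ ^ 2 := by
  have hne : (weilWindowSphereValues (fun g : ℝ → ℂ => ∀ t, g (-t) = g t) b).Nonempty := by
    obtain ⟨g, hg, hs, hev, hn⟩ := exists_isWeilTest_even_sphere hb
    exact ⟨_, g, hg, hs, hev, hn, rfl⟩
  have hlt : sInf (weilWindowSphereValues (fun g : ℝ → ℂ => ∀ t, g (-t) = g t) b) < E := by
    rwa [← weilEvenGroundEnergy_eq_sInf]
  obtain ⟨x, ⟨g, hg, hs, hev, hn, rfl⟩, hxE⟩ := exists_lt_of_csInf_lt hne hlt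
  set gr : ℝ → ℂ := fun t => (((g t).re : ℝ) : ℂ) with hgr_def
  set gi : ℝ → ℂ := fun t => (((g t).im : ℝ) : ℂ) with hgi_def
  have hgr : IsWeilTest gr := isWeilTest_ofReal_re hg
  have hgi : IsWeilTest gi := isWeilTest_ofReal_im hg
  have hsr : tsupport gr ⊆ Icc (-b) b := (tsupport_ofReal_re_subset g).trans hs
  have hsi : tsupport gi ⊆ Icc (-b) b := (tsupport_ofReal_im_subset g).trans hs
  have hevr : ∀ t, gr (-t) = gr t := fun t => by simp [hgr_def, hev t]
  have hevi : ∀ t, gi (-t) = gi t := fun t => by simp [hgi_def, hev t]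
  have hrer : ∀ t, (gr t).im = 0 := fun t => Complex.ofReal_im _
  have hrei : ∀ t, (gi t).im = 0 := fun t => Complex.ofReal_im _
  have hQ := re_weilQuadratic_eq_re_add_im hg
  have hM := integral_norm_sq_eq_re_add_im hg
  rw [hn] at hM
  have hlr := weilEvenGroundEnergy_mul_le_re hgr hsr hevr
  have hli := weilEvenGroundEnergy_mul_le_re hgi hsi hevi
  have hmr : 0 ≤ ∫ t, ‖gr t‖ ^ 2 := integral_nonneg fun _ => by positivity
  have hmi : 0 ≤ ∫ t, ‖gi t‖ ^ 2 := integral_nonneg fun _ => by positivity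
  by_cases hr : (weilQuadratic gr).re < E * ∫ t, ‖gr t‖ ^ 2
  · refine ⟨gr, hgr, hsr, hevr, hrer, ?_, hr⟩
    rcases hmr.eq_or_lt with h0 | h0
    · exfalso
      rw [← h0, mul_zero] at hr
      rw [← h0, mul_zero] at hlr
      linarith
    · exact h0
  · push Not at hr
    have htot : (weilQuadratic g).re < E * ((∫ t, ‖gr t‖ ^ 2) + ∫ t, ‖gi t‖ ^ 2) := by
      rw [← hM, mul_one]; exact hxE
    have hi : (weilQuadratic gi).re < E * ∫ t, ‖gi t‖ ^ 2 := by
      rw [hQ] at htot; linarith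
    refine ⟨gi, hgi, hsi, hevi, hrei, ?_, hi⟩
    rcases hmi.eq_or_lt with h0 | h0
    · exfalso
      rw [← h0, mul_zero] at hi
      rw [← h0, mul_zero] at hli
      linarith
    · exact h0

/-! ## §4 The even up-dial twin in the continuum: real, even, and its autocorrelation at lag `log p` -/

section Twin

variable {g : ℝ → ℂ} {b c : ℝ}

/-- PROVED: the `σ = -1` twin `τ_{-c} g + τ_{c} g` of a real-valued `g` is real-valued. [folklore] -/
theorem twin_im_eq_zero (hre : ∀ t, (g t).im = 0) (c : ℝ) (x : ℝ) : (twin c (-1) g x).im = 0 := by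
  simp [twin, PfPersistenceF5TailTwins.translate, hre]

/-- PROVED: the `σ = -1` twin of an EVEN `g` is EVEN. [folklore] -/
theorem twin_even (hev : ∀ t, g (-t) = g t) (c : ℝ) (x : ℝ) : twin c (-1) g (-x) = twin c (-1) g x := by
  simp only [twin, PfPersistenceF5TailTwins.translate]
  rw [show -x - -c = -(x - c) by ring, show -x - c = -(x - -c) by ring, hev, hev]
  push_cast
  ring

/-- PROVED: pointwise, for a real-valued `g` on `[-b, b]` and `b < c`,
`Re twin(u) · Re twin(u + 2c) = ‖g(u + c)‖²` (from F5's `twin_mul_conj_twin_add`). [folklore] -/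
theorem re_twin_mul_re_twin_add (hs : tsupport g ⊆ Icc (-b) b) (hb : 0 < b) (hbc : b < c)
    (hre : ∀ t, (g t).im = 0) (u : ℝ) :
    (twin c (-1) g u).re * (twin c (-1) g (u + 2 * c)).re = ‖g (u + c)‖ ^ 2 := by
  have h := congrArg Complex.re (twin_mul_conj_twin_add hs hb hbc (-1) u)
  have him := twin_im_eq_zero hre c
  simp only [Complex.mul_re, Complex.conj_re, Complex.conj_im, him, neg_zero, mul_zero, sub_zero,
    Complex.neg_re, Complex.ofReal_re, Complex.ofReal_im, Complex.neg_im] at h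
  rw [h]
  ring

/-- PROVED: the windowed autocorrelation of the real twin at lag `2c` over the window `[-(c+b), c+b]` is the
mass of `g`: `∫_{-(c+b)}^{(c+b)-2c} Re twin(x) Re twin(x + 2c) dx = ∫ ‖g‖²`. [folklore] -/
theorem integral_re_twin_mul_shift (hg : IsWeilTest g) (hs : tsupport g ⊆ Icc (-b) b) (hb : 0 < b)
    (hbc : b < c) (hre : ∀ t, (g t).im = 0) :
    ∫ x in (-(c + b))..(c + b - 2 * c), (twin c (-1) g x).re * (twin c (-1) g (x + 2 * c)).re
      = ∫ t, ‖g t‖ ^ 2 := by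
  simp_rw [re_twin_mul_re_twin_add hs hb hbc hre]
  rw [intervalIntegral.integral_comp_add_right (fun t => ‖g t‖ ^ 2) c,
    show -(c + b) + c = -b by ring, show c + b - 2 * c + c = b by ring]
  apply intervalIntegral.integral_eq_integral_of_support_subset
  intro t ht
  have ht' : t ∈ Function.support g := by
    rw [Function.mem_support] at ht ⊢
    intro h0
    exact ht (by simp [h0])
  have hopen : IsOpen (Function.support g) := isOpen_compl_singleton.preimage hg.1.continuous
  have hsub : Function.support g ⊆ interior (Icc (-b) b) :=
    hopen.subset_interior_iff.2 ((subset_tsupport g).trans hs)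
  rw [interior_Icc] at hsub
  exact Ioo_subset_Ioc_self (hsub ht')

end Twin

/-! ## §5 Autocorrelations move little under sup-approximation on the window -/

/-- PROVED (elementary): if `|θ_v − h| ≤ δ` on `[-a, a]` and `|h| ≤ M`, then for every lag `0 ≤ y ≤ 2a` the
windowed autocorrelations of `θ_v` and of `h` differ by at most `2a·δ(2M + δ)`. [folklore] -/
theorem abs_autocorr_sub_integral_le {a : ℝ} {N : ℕ} (v : Fin (N + 1) → ℝ) {h : ℝ → ℝ} (hh : Continuous h)
    {δ M : ℝ} (hδ : 0 ≤ δ) (hM : ∀ x, |h x| ≤ M)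
    (hclose : ∀ x ∈ Icc (-a) a, |profile (2 * a) v x - h x| ≤ δ) {y : ℝ} (hy0 : 0 ≤ y) (hy : y ≤ 2 * a) :
    |autocorr (2 * a) v y - ∫ x in (-a)..(a - y), h x * h (x + y)| ≤ 2 * a * (δ * (2 * M + δ)) := by
  have hM0 : 0 ≤ M := (abs_nonneg _).trans (hM 0)
  have hab : -a ≤ a - y := by linarith
  unfold autocorr
  rw [show -(2 * a / 2) = -a by ring, show 2 * a / 2 - y = a - y by ring]
  set G : ℝ → ℝ := fun x => profile (2 * a) v x with hG
  have hGc : Continuous G := CentralMassFloor.continuous_profile (2 * a) v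
  have hf : Continuous fun x => G x * G (x + y) := hGc.mul (hGc.comp (continuous_add_const y))
  have hg : Continuous fun x => h x * h (x + y) := hh.mul (hh.comp (continuous_add_const y))
  rw [← intervalIntegral.integral_sub (hf.intervalIntegrable _ _) (hg.intervalIntegrable _ _)]
  have hpt : ∀ x ∈ Set.uIoc (-a) (a - y), ‖G x * G (x + y) - h x * h (x + y)‖ ≤ δ * (2 * M + δ) := by
    intro x hx
    rw [Set.uIoc_of_le hab] at hx
    have hx1 : x ∈ Icc (-a) a := ⟨hx.1.le, by linarith [hx.2]⟩
    have hx2 : x + y ∈ Icc (-a) a := ⟨by linarith [hx.1], by linarith [hx.2]⟩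
    have e1 := hclose x hx1
    have e2 := hclose (x + y) hx2
    have b1 := hM x
    have hGxy : |G (x + y)| ≤ M + δ := by
      have := abs_sub_abs_le_abs_sub (G (x + y)) (h (x + y))
      linarith [hM (x + y)]
    rw [Real.norm_eq_abs,
      show G x * G (x + y) - h x * h (x + y) = (G x - h x) * G (x + y) + h x * (G (x + y) - h (x + y)) by ring]
    calc |(G x - h x) * G (x + y) + h x * (G (x + y) - h (x + y))|
        ≤ |G x - h x| * |G (x + y)| + |h x| * |G (x + y) - h (x + y)| := by
          refine (abs_add_le _ _).trans ?_
          rw [abs_mul, abs_mul]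
      _ ≤ δ * (M + δ) + M * δ :=
          add_le_add (mul_le_mul e1 hGxy (abs_nonneg _) hδ) (mul_le_mul b1 e2 (abs_nonneg _) hM0)
      _ = δ * (2 * M + δ) := by ring
  calc |∫ x in (-a)..(a - y), (G x * G (x + y) - h x * h (x + y))|
      = ‖∫ x in (-a)..(a - y), (G x * G (x + y) - h x * h (x + y))‖ := (Real.norm_eq_abs _).symm
    _ ≤ δ * (2 * M + δ) * |a - y - -a| := intervalIntegral.norm_integral_le_of_norm_le_const hpt
    _ ≤ 2 * a * (δ * (2 * M + δ)) := by
        rw [show a - y - -a = 2 * a - y by ring, abs_of_nonneg (by linarith)]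
        have hK : 0 ≤ δ * (2 * M + δ) := mul_nonneg hδ (by linarith)
        nlinarith

/-! ## §6 `ζ`'s weight at a prime; uniform closeness is monotone in the radius -/

/-- PROVED: `w_ζ(p) = log p / √p` at a prime. [folklore] -/
theorem zetaWeights_prime {p : ℕ} (hp : p.Prime) : zetaWeights p = Real.log p / Real.sqrt p := by
  unfold zetaWeights
  rw [ArithmeticFunction.vonMangoldt_apply_prime hp, Real.sqrt_eq_rpow, Real.rpow_neg (Nat.cast_nonneg p)]
  ring

/-- PROVED: uniform closeness at radius `ε` persists at every larger radius. [folklore] -/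
theorem UniformlyClose.of_le {ε ε' : ℝ} {d d' : Datum} (h : UniformlyClose ε d d') (hle : ε ≤ ε') :
    UniformlyClose ε' d d' :=
  fun win v => (h win v).trans (mul_le_mul_of_nonneg_right hle (dotProduct_self_nonneg_real v))

/-! ## §7 The continuum step: under window positivity, the even up-dial twin has `Re Q_ζ < 2tw(p)·mass` -/

/-- PROVED (F5-A with `K = 1 + t > 1`, restated on `Q_ζ`): if `ζ` is Weil-positive on the window `log p/2 + b`,
`g₁` is a test on `[-b, b]` (`2b < log p`) with `Re Q(g₁) ≤ E·‖g₁‖²`, `‖g₁‖² > 0` and `2E < t·log p/√p`, then the even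
twin `g = τ_{-log p/2} g₁ + τ_{log p/2} g₁` satisfies `Re Q_ζ(g) < 2t(log p/√p)‖g₁‖²` — i.e. the dialled form
`Q_ζ(g) − 2t·w(p)·A_g(log p)` is negative (`A_g(log p) = ‖g₁‖²`). [folklore] -/
theorem re_weilQuadratic_twin_lt {p : ℕ} (hp : p.Prime) {t b E : ℝ} (ht : 0 < t) (hb : 0 < b)
    (hb2 : 2 * b < Real.log p) (hW : WeilPositivityOn (Real.log p / 2 + b)) {g₁ : ℝ → ℂ} (hg : IsWeilTest g₁)
    (hs : tsupport g₁ ⊆ Icc (-b) b) (hq : (weilQuadratic g₁).re ≤ E * ∫ x, ‖g₁ x‖ ^ 2)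
    (hm : 0 < ∫ x, ‖g₁ x‖ ^ 2) (hE : 2 * E < t * Real.log p / Real.sqrt p) :
    (weilQuadratic (twin (Real.log p / 2) (-1) g₁)).re
      < 2 * t * (Real.log p / Real.sqrt p) * ∫ x, ‖g₁ x‖ ^ 2 := by
  have hsign : (SignType.sign (1 - (1 + t)) : ℝ) = -1 := by
    rw [show (1 : ℝ) - (1 + t) = -t by ring, sign_neg (neg_lt_zero.2 ht), SignType.coe_neg_one]
  have habs : |1 - (1 + t)| = t := by
    rw [show (1 : ℝ) - (1 + t) = -t by ring, abs_neg, abs_of_pos ht]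
  have h := tailDialNegativeOrZetaNotPositive p hp (1 + t) b E (by linarith) hb hb2 g₁ hg hs hq hm
    (by rw [habs]; exact hE)
  have htw : tailTwinTest p (1 + t) g₁ = twin (Real.log p / 2) (-1) g₁ := by
    unfold tailTwinTest; rw [hsign]
  rw [htw] at h
  rcases h with h | h
  · exact absurd hW h
  -- the dial correction, as in F5's proof: `Re Q_{p,K}(g) = Re Q_ζ(g) − 2|1−K|(log p/√p)‖g₁‖²`
  set c : ℝ := Real.log p / 2 with hc_def
  have hc0 : 0 < c := by rw [hc_def]; linarith
  have hbc : b < c := by rw [hc_def]; linarith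
  have hc2 : 2 * c = Real.log p := by rw [hc_def]; ring
  have htws : tsupport (twin c (-1) g₁) ⊆ Icc (-(c + b)) (c + b) := tsupport_twin_subset hs hc0.le (-1)
  have hAs := tsupport_weilConv_weilReflect_subset (isWeilTest_twin hg c (-1)).2 htws
  have hAz : ∀ x : ℝ, 2 * (c + b) < |x| →
      weilConv (twin c (-1) g₁) (weilReflect (twin c (-1) g₁)) x = 0 := by
    intro x hx
    refine eq_zero_of_tsupport_subset hAs fun hmem => ?_
    simp only [mem_Icc] at hmem
    have : |x| ≤ 2 * (c + b) := abs_le.2 ⟨by linarith, by linarith⟩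
    linarith
  have hA1 : weilConv (twin c (-1) g₁) (weilReflect (twin c (-1) g₁)) (Real.log p)
      = -((-1 : ℝ) : ℂ) * ((∫ x, ‖g₁ x‖ ^ 2 : ℝ) : ℂ) := by
    rw [← hc2]; exact weilConv_weilReflect_twin_two_mul hs hb hbc (-1)
  have hA2 : weilConv (twin c (-1) g₁) (weilReflect (twin c (-1) g₁)) (-Real.log p)
      = -((-1 : ℝ) : ℂ) * ((∫ x, ‖g₁ x‖ ^ 2 : ℝ) : ℂ) := by
    rw [← hc2]; exact weilConv_weilReflect_twin_neg_two_mul hs hb hbc (-1)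
  have hdial : (dialQuadratic p (1 + t) (twin c (-1) g₁)).re =
      (weilQuadratic (twin c (-1) g₁)).re - 2 * t * (Real.log p / Real.sqrt p) * ∫ x, ‖g₁ x‖ ^ 2 := by
    rw [dialQuadratic_eq, weilPrimeTerm_sub_dialPrimeTerm hp (1 + t) hAz (by linarith), hA1, hA2,
      Complex.add_re]
    have : ((((1 - (1 + t)) * (Real.log p / Real.sqrt p) : ℝ) : ℂ) *
        (-((-1 : ℝ) : ℂ) * ((∫ x, ‖g₁ x‖ ^ 2 : ℝ) : ℂ) + -((-1 : ℝ) : ℂ) * ((∫ x, ‖g₁ x‖ ^ 2 : ℝ) : ℂ)))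
        = ((-(2 * t * (Real.log p / Real.sqrt p) * ∫ x, ‖g₁ x‖ ^ 2) : ℝ) : ℂ) := by
      push_cast; ring
    rw [this, Complex.ofReal_re]
    ring
  rw [hdial] at h
  linarith

end Summit.RiemannHypothesis.RiemannHypothesis.Theorems.PfPersistence

end
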